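import Summits.MatrixMultiplication.MatrixMultiplication.Theses.CharacteristicContinuity
import Literature.Computability.AlgebraicComplexity.MatMulRankLowerBoundsBlaserProofs
import HarnessLib

/-!
# CharacteristicContinuityFixedFormat — the Lefschetz leaf of the characteristic axis
(decomp-mm cell, lens 5 «finite/base range + asymptotic regime + bridge», generation 9)

Landing form (part 1 of 2) for the open `provable-now` items of the dormant route
`route-MatrixMultiplication-CharacteristicContinuity` (`Theses/CharacteristicContinuity.lean`); this file
closes item 18044, the sequel `CharacteristicContinuityUniformWitness.lean` closes 18043 and 18046:

* `fixedFormatContinuity_holds : FixedFormatContinuity` — item `stmt-MatrixMultiplication-18044`: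
  for every format `(k, m, n)` the rank `R(⟨k,m,n⟩)` is EVENTUALLY CHARACTERISTIC-INDEPENDENT,
  `R_{𝔽̄_p}(⟨k,m,n⟩) = R_ℂ(⟨k,m,n⟩)` for all large primes `p`.  The `≤`-half has a
  denominator-clearing proof (landed `CharacteristicContinuityTransfer.tensorRank_algClosure_le_rat_eventually`,
  with `R_ℚ`); the `≥`-half (complex LOWER bounds transfer to large characteristic) has none, and both
  halves are obtained here at once from the **Lefschetz principle** (Mathlib
  `FirstOrder.Field.finite_ACF_prime_not_realize_of_ACF_zero_realize`, completeness of `ACF_p`)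
  applied to the BRENT SENTENCE `∃ x ⋀_{abc} (∑_i x_{i,a} x_{i,b} x_{i,c} = ⟨k,m,n⟩_{abc})`
  (`exists_brentSentence : ∃ φ, ∀ K, K ⊨ φ ↔ R_K(⟨k,m,n⟩) ≤ r`; pointwise transfer
  `realize_algClosure_iff_complex_eventually : 𝔽̄_p ⊨ φ ↔ ℂ ⊨ φ` for `p ≥ p₀(φ)`), for the finitely many
  `r ≤ kmn` at once (`tensorRank_le_iff_eventually`).
* (sequel) `uniformWitnessIff_holds` (18043) and `assembly_holds` (18046).

Lens reading: on the characteristic axis the BASE RANGE is a fixed format, the ASYMPTOTIC REGIME is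
`p → ∞`, and `fixedFormatContinuity_holds` is the BRIDGE that is a theorem; the sequel's
`uniformWitnessIff_holds` says precisely how far the finite range must reach for the bridge to bite on
`ω` itself: the witness size `N(ε)` must be bounded uniformly in `p` — which is the residual K.

References: [cite: BurgisserClausenShokrollahi1997, Cor. (15.18) and p. 410];
[cite: Blaser2013, Def. 5.1, §4–5]; [cite: HeuleKauersSeidl2021, §2 (the Brent equations)].
-/

set_option linter.dupNamespace false -- `MatrixMultiplication.MatrixMultiplication` (summit = problem, D-0017)

noncomputable section

open Filter Finset
open FirstOrder FirstOrder.Language FirstOrder.Ring FirstOrder.Field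
open Literature.Computability.AlgebraicComplexity
open Summit.MatrixMultiplication.MatrixMultiplication.Theses.CharacteristicContinuity

namespace Summit.MatrixMultiplication.MatrixMultiplication.Theorems.CharacteristicContinuityFixedFormat

/-! ## The Brent sentence of a format and a rank bound -/

/-- Padding: if `R(t) ≤ r` then `t` is a sum of exactly `r` triads (an optimal decomposition,
`exists_triad_decomposition_tensorRank`, extended by zero triads). [cite: Blaser2013, §4 (rank of a tensor)] -/
theorem exists_eq_sum_triad_of_tensorRank_le {K : Type*} [CommSemiring K] {ι κ μ : Type*}
    [Fintype ι] [Fintype κ] [Fintype μ] (t : ι → κ → μ → K) {r : ℕ} (hr : tensorRank t ≤ r) :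
    ∃ (w : Fin r → ι → K) (u : Fin r → κ → K) (v : Fin r → μ → K),
      t = ∑ s, triad (w s) (u s) (v s) := by
  classical
  obtain ⟨w, u, v, h⟩ := exists_triad_decomposition_tensorRank t
  let w' : Fin r → ι → K := fun s => if hs : (s : ℕ) < tensorRank t then w ⟨s, hs⟩ else 0
  let u' : Fin r → κ → K := fun s => if hs : (s : ℕ) < tensorRank t then u ⟨s, hs⟩ else 0
  let v' : Fin r → μ → K := fun s => if hs : (s : ℕ) < tensorRank t then v ⟨s, hs⟩ else 0
  refine ⟨w', u', v', ?_⟩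
  have hmap : ∑ s ∈ (univ : Finset (Fin (tensorRank t))).map (Fin.castLEEmb hr),
      triad (w' s) (u' s) (v' s) = ∑ i, triad (w i) (u i) (v i) := by
    rw [sum_map]
    refine sum_congr rfl fun i _ => ?_
    simp [w', u', v', Fin.castLEEmb, i.isLt]
  rw [h, ← hmap]
  refine sum_subset (subset_univ _) fun s _ hs => ?_
  have hsR : ¬ (s : ℕ) < tensorRank t := fun hlt =>
    hs (mem_map.2 ⟨⟨s, hlt⟩, mem_univ _, Fin.ext rfl⟩)
  funext a b c
  simp [w', hsR, triad]

/-- **Common zeros of finitely many integer polynomials are expressed by ONE sentence of the language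
of rings**, uniformly in the ring: `K ⊨ ∃ x ⋀_e P_e(x) = 0` iff some `x ∈ K^V` is a common zero of the
`P_e` (the device of Mathlib's `FirstOrder.Ring.termOfFreeCommRing`; Ax–Grothendieck file). [folklore] -/
theorem realize_commonZeroSentence {V E : Type} [Finite V] [Finite E] (P : E → FreeCommRing V)
    (K : Type*) [CommRing K] [CompatibleRing K] :
    K ⊨ ((Formula.iInf fun e => Term.equal (termOfFreeCommRing (P e)) 0).relabel
          (Sum.inr : V → Empty ⊕ V)).iExs V ↔
      ∃ x : V → K, ∀ e, FreeCommRing.lift x (P e) = 0 := by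
  rw [Sentence.Realize, Formula.realize_iExs]
  refine exists_congr fun x => ?_
  rw [Formula.realize_relabel]
  refine (Iff.of_eq (congrArg (Formula.iInf fun e => Term.equal (termOfFreeCommRing (P e)) 0).Realize
    (funext fun a => rfl : (fun a => Sum.elim (default : Empty → K) x (Sum.inr a)) = x))).trans ?_
  simp only [Formula.realize_iInf, Formula.realize_equal, realize_termOfFreeCommRing, realize_zero]

/-- **The Brent sentence.** For every format `(k, m, n)` and every `r` there is ONE sentence `φ` of the
language of rings — `∃ x ⋀_{abc} (∑_{i<r} x_{i,a} y_{i,b} z_{i,c} = ⟨k,m,n⟩_{abc})` — such that for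
every field `K`: `K ⊨ φ ↔ R_K(⟨k,m,n⟩) ≤ r`. [cite: BurgisserClausenShokrollahi1997, p. 410]
[cite: HeuleKauersSeidl2021, §2 (the Brent equations)] -/
theorem exists_brentSentence (k m n r : ℕ) :
    ∃ φ : Language.ring.Sentence, ∀ (K : Type) [Field K] [CompatibleRing K],
      K ⊨ φ ↔ tensorRank (matMulTensor K k m n) ≤ r := by
  classical
  -- the Brent polynomials, as elements of the free commutative ring on the coordinates
  let P : (Fin k × Fin n) × ((Fin k × Fin m) × (Fin m × Fin n)) →
      FreeCommRing (Fin r × ((Fin k × Fin n) ⊕ ((Fin k × Fin m) ⊕ (Fin m × Fin n)))) :=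
    fun e => (∑ i : Fin r, FreeCommRing.of (i, Sum.inl e.1) *
        FreeCommRing.of (i, Sum.inr (Sum.inl e.2.1)) * FreeCommRing.of (i, Sum.inr (Sum.inr e.2.2))) -
      ((matMulTensor ℤ k m n e.1 e.2.1 e.2.2 : ℤ) : FreeCommRing _)
  refine ⟨_, fun K _ _ => (realize_commonZeroSentence P K).trans ?_⟩
  -- evaluating a Brent polynomial at a point
  have hT : ∀ a b c, ((matMulTensor ℤ k m n a b c : ℤ) : K) = matMulTensor K k m n a b c :=
    fun a b c => congrFun (congrFun (congrFun (matMulTensor_map (Int.castRingHom K) k m n) a) b) c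
  have hlift : ∀ (x : Fin r × ((Fin k × Fin n) ⊕ ((Fin k × Fin m) ⊕ (Fin m × Fin n))) → K)
      (e : (Fin k × Fin n) × ((Fin k × Fin m) × (Fin m × Fin n))),
      FreeCommRing.lift x (P e) =
        (∑ i : Fin r, x (i, Sum.inl e.1) * x (i, Sum.inr (Sum.inl e.2.1)) *
            x (i, Sum.inr (Sum.inr e.2.2))) - matMulTensor K k m n e.1 e.2.1 e.2.2 := by
    intro x e
    simp only [P, map_sub, map_sum, map_mul, FreeCommRing.lift_of, map_intCast, hT]
  -- zeros of the Brent polynomials are the `r`-term decompositions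
  have hzero : ∀ x : Fin r × ((Fin k × Fin n) ⊕ ((Fin k × Fin m) ⊕ (Fin m × Fin n))) → K,
      (∀ e, FreeCommRing.lift x (P e) = 0) ↔
        matMulTensor K k m n = ∑ i : Fin r, triad (fun a => x (i, Sum.inl a))
          (fun b => x (i, Sum.inr (Sum.inl b))) (fun c => x (i, Sum.inr (Sum.inr c))) := by
    intro x
    simp only [hlift, sub_eq_zero]
    constructor
    · intro h
      funext a b c
      rw [Finset.sum_apply, Finset.sum_apply, Finset.sum_apply]
      simpa only [triad_apply] using (h (a, (b, c))).symm
    · rintro h ⟨a, b, c⟩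
      have habc := congrFun (congrFun (congrFun h a) b) c
      rw [Finset.sum_apply, Finset.sum_apply, Finset.sum_apply] at habc
      simpa only [triad_apply] using habc.symm
  constructor
  · rintro ⟨x, hx⟩
    exact tensorRank_le_of_eq_sum _ _ _ ((hzero x).1 hx)
  · intro hr
    obtain ⟨w, u, v, h⟩ := exists_eq_sum_triad_of_tensorRank_le _ hr
    refine ⟨fun q => Sum.elim (w q.1) (Sum.elim (u q.1) (v q.1)) q.2, (hzero _).2 ?_⟩
    simpa using h

/-! ## Lefschetz transfer: complex truth = truth in cofinitely many characteristics -/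

/-- A finite set of primes is bounded. [folklore] -/
theorem exists_bound_of_finite {s : Set Nat.Primes} (hs : s.Finite) :
    ∃ p₀ : ℕ, ∀ q : Nat.Primes, p₀ ≤ (q : ℕ) → q ∉ s := by
  refine ⟨hs.toFinset.sup (fun q : Nat.Primes => (q : ℕ)) + 1, fun q hq hmem => ?_⟩
  have hle : (q : ℕ) ≤ hs.toFinset.sup (fun q : Nat.Primes => (q : ℕ)) :=
    Finset.le_sup (f := fun q : Nat.Primes => (q : ℕ)) (hs.mem_toFinset.2 hmem)
  omega

/-- **Lefschetz, one direction, with an explicit threshold**: a sentence true in `ACF₀` holds in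
`ACF_p` for all primes `p ≥ p₀`. [cite: BurgisserClausenShokrollahi1997, p. 410] -/
theorem acf_prime_models_of_acf_zero (ψ : Language.ring.Sentence) (h : Theory.ACF 0 ⊨ᵇ ψ) :
    ∃ p₀ : ℕ, ∀ p : ℕ, p.Prime → p₀ ≤ p → Theory.ACF p ⊨ᵇ ψ := by
  obtain ⟨p₀, hp₀⟩ :=
    exists_bound_of_finite (finite_ACF_prime_not_realize_of_ACF_zero_realize ψ h)
  refine ⟨p₀, fun p hp hle => ?_⟩
  have hmem := hp₀ ⟨p, hp⟩ hle
  simp only [Set.mem_setOf_eq, not_not] at hmem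
  exact hmem

/-- **Lefschetz principle for one sentence, pointwise**: for all large primes `p`, a sentence of the
language of rings holds in `𝔽̄_p` iff it holds in `ℂ` (completeness of `ACF_p`, `ACF₀` and Mathlib's
`finite_ACF_prime_not_realize_of_ACF_zero_realize`, applied to `φ` or to `¬φ`).
[cite: BurgisserClausenShokrollahi1997, p. 410] -/
theorem realize_algClosure_iff_complex_eventually (φ : Language.ring.Sentence) :
    ∃ p₀ : ℕ, ∀ (p : ℕ) [Fact p.Prime], p₀ ≤ p →
      ((letI := compatibleRingOfRing (AlgebraicClosure (ZMod p)); AlgebraicClosure (ZMod p) ⊨ φ) ↔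
        (letI := compatibleRingOfRing ℂ; ℂ ⊨ φ)) := by
  classical
  letI := compatibleRingOfRing ℂ
  by_cases hC : ℂ ⊨ φ
  · have h0 : Theory.ACF 0 ⊨ᵇ φ :=
      ((ACF_isComplete (Or.inr rfl)).realize_sentence_iff φ ℂ).1 hC
    obtain ⟨p₀, hp₀⟩ := acf_prime_models_of_acf_zero φ h0
    refine ⟨p₀, fun p inst hp => ?_⟩
    letI := compatibleRingOfRing (AlgebraicClosure (ZMod p))
    exact iff_of_true (((ACF_isComplete (Or.inl inst.out)).realize_sentence_iff φ
      (AlgebraicClosure (ZMod p))).2 (hp₀ p inst.out hp)) hC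
  · have hCn : ℂ ⊨ φ.not := (Sentence.realize_not ℂ).2 hC
    have h0 : Theory.ACF 0 ⊨ᵇ φ.not :=
      ((ACF_isComplete (Or.inr rfl)).realize_sentence_iff φ.not ℂ).1 hCn
    obtain ⟨p₀, hp₀⟩ := acf_prime_models_of_acf_zero φ.not h0
    refine ⟨p₀, fun p inst hp => ?_⟩
    letI := compatibleRingOfRing (AlgebraicClosure (ZMod p))
    exact iff_of_false ((Sentence.realize_not (AlgebraicClosure (ZMod p))).1
      (((ACF_isComplete (Or.inl inst.out)).realize_sentence_iff φ.not
        (AlgebraicClosure (ZMod p))).2 (hp₀ p inst.out hp))) hC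

/-- **Each rank bound is eventually characteristic-independent**: for all large primes `p`,
`R_{𝔽̄_p}(⟨k,m,n⟩) ≤ r ↔ R_ℂ(⟨k,m,n⟩) ≤ r` (Lefschetz on the Brent sentence).
[cite: BurgisserClausenShokrollahi1997, p. 410] -/
theorem tensorRank_le_iff_eventually (k m n r : ℕ) :
    ∃ p₀ : ℕ, ∀ (p : ℕ) [Fact p.Prime], p₀ ≤ p →
      (tensorRank (matMulTensor (AlgebraicClosure (ZMod p)) k m n) ≤ r ↔
        tensorRank (matMulTensor ℂ k m n) ≤ r) := by
  obtain ⟨φ, hφ⟩ := exists_brentSentence k m n r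
  obtain ⟨p₀, hp₀⟩ := realize_algClosure_iff_complex_eventually φ
  refine ⟨p₀, fun p inst hp => ?_⟩
  have h := hp₀ p hp
  letI := compatibleRingOfRing ℂ
  letI := compatibleRingOfRing (AlgebraicClosure (ZMod p))
  rwa [hφ ℂ, hφ (AlgebraicClosure (ZMod p))] at h

/-! ## Item 18044: fixed-format continuity -/

/-- **Item `stmt-MatrixMultiplication-18044` (`FixedFormatContinuity`)**: for every format the rank of
`⟨k,m,n⟩` over `𝔽̄_p` equals the rank over `ℂ` for all large primes `p` (both transfer directions
over the finitely many `r ≤ kmn`). [cite: BurgisserClausenShokrollahi1997, Cor. (15.18) and p. 410] -/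
theorem fixedFormatContinuity_holds : FixedFormatContinuity := by
  intro k m n
  have hall : ∀ r : Fin (k * m * n + 1), ∃ p₀ : ℕ, ∀ (p : ℕ) [Fact p.Prime], p₀ ≤ p →
      (tensorRank (matMulTensor (AlgebraicClosure (ZMod p)) k m n) ≤ r ↔
        tensorRank (matMulTensor ℂ k m n) ≤ r) :=
    fun r => tensorRank_le_iff_eventually k m n r
  choose P hP using hall
  refine ⟨Finset.univ.sup P, fun p inst hp => ?_⟩
  have hle : ∀ r : Fin (k * m * n + 1), P r ≤ p :=
    fun r => (Finset.le_sup (f := P) (Finset.mem_univ r)).trans hp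
  apply le_antisymm
  · have hC : tensorRank (matMulTensor ℂ k m n) < k * m * n + 1 :=
      Nat.lt_succ_of_le (tensorRank_matMulTensor_le ℂ k m n)
    exact (hP ⟨_, hC⟩ p (hle _)).2 le_rfl
  · have hF : tensorRank (matMulTensor (AlgebraicClosure (ZMod p)) k m n) < k * m * n + 1 :=
      Nat.lt_succ_of_le (tensorRank_matMulTensor_le (AlgebraicClosure (ZMod p)) k m n)
    exact (hP ⟨_, hF⟩ p (hle _)).1 le_rfl

end Summit.MatrixMultiplication.MatrixMultiplication.Theorems.CharacteristicContinuityFixedFormat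

end
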